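import Mathlib
import Literature.NumberTheory.ModularForms.LevelTwoThetaForms
import HarnessLib

/-!
# Reduction theory for `Γ₀(2)⁺ = ⟨Γ₀(2), W₂⟩`: the fundamental domain `{|Re z| ≤ ½, |z|² ≥ ½}`

[topic NumberTheory/ModularForms]

The group generated by `Γ₀(2) ⊂ SL₂(ℤ)` (Mathlib's action on `ℍ`) and the Fricke involution
`W₂ : z ↦ −1/(2z)` (`frickeTwo` of `LevelTwoThetaForms.lean`) has the `SL₂(ℤ)`-shaped fundamental
domain `𝒟₂ = {|Re z| ≤ ½, |z|² ≥ ½}` with corners `∓½ + i/2` (the elliptic points of order `2`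
of `Γ₀(2)`, `cmLevelTwo` of Zhou 2015, Remark 9). We prove what the level-2 Green-function
construction needs (cf. Mathlib's `Modular.lean` for `SL₂(ℤ)`):

* `frickeTwo_smul`: `W₂(γ•z) = γ^{W}•(W₂ z)` with `γ^W = (d, −c/2; −2b, a) ∈ Γ₀(2)`
  (`frickeConj`), `frickeTwo_frickeTwo : W₂(W₂ z) = z`; the orbit `orbTwo z` of `z` under
  `Γ₀(2)⁺` and its stability (`orbTwo_smul`, `orbTwo_frickeTwo`, `orbTwo_eq_of_mem`);
* **`𝒟₂`-points have maximal height in their orbit** (`im_le_of_mem_fdTwo`): for `u ∈ 𝒟₂`,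
  `γ ∈ Γ₀(2)`: `Im(γ•u) ≤ Im u` and `Im(γ•W₂u) ≤ Im u` (the latter from
  `Im(γ W₂ u) = 2 Im u/|2du − c|²` and `|2du − c|² ≥ 2`), with the equality cases off the corners:
  `γ•u = u + n`, resp. `|u|² = ½` and `γ•W₂u = W₂u + n` (`eq_vadd_of_im_eq`,
  `eq_vadd_fricke_of_im_eq`);
* points of `𝒟₂` have `Im ≥ ½` with equality exactly at the corners (`half_le_im_of_mem_fdTwo`,
  `im_eq_half_iff`); hence orbit points of the corner have height `≤ ½`;
* **existence of representatives** (`exists_mem_orbTwo_mem_fdTwo`): every orbit meets `𝒟₂`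
  (height maximisation over the orbit, via Mathlib's `tendsto_normSq_coprime_pair` and
  `bottom_row_surj`).

## References
* Zhou 2015, Remark 9 (level `2`). [cite: Zhou2015, Remark 9]
* standard reduction theory for Fricke groups. [folklore]
-/

noncomputable section

open Complex hiding I
open UpperHalfPlane hiding I
open Filter Topology CongruenceSubgroup
open scoped MatrixGroups ModularForm

namespace Literature.NumberTheory.ModularForms

/-! ## `Γ₀(2)` membership and the Fricke conjugation -/

/-- `γ ∈ Γ₀(2) ↔ 2 ∣ c`. [folklore] -/
theorem mem_Gamma0_two_iff (γ : SL(2, ℤ)) : γ ∈ Gamma0 2 ↔ (2 : ℤ) ∣ γ 1 0 := by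
  rw [Gamma0_mem]
  exact ZMod.intCast_zmod_eq_zero_iff_dvd _ 2

/-- The determinant relation `ad − bc = 1`. [folklore] -/
theorem det_two_entries (γ : SL(2, ℤ)) : γ 0 0 * γ 1 1 - γ 0 1 * γ 1 0 = 1 := by
  have := Matrix.SpecialLinearGroup.det_coe γ
  rw [Matrix.det_fin_two] at this
  linarith

/-- **The Fricke conjugate** `γ^W := W₂ γ W₂⁻¹ = (d, −c/2; −2b, a)` of `γ ∈ Γ₀(2)`. [folklore] -/
def frickeConj (γ : SL(2, ℤ)) (hγ : γ ∈ Gamma0 2) : SL(2, ℤ) :=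
  ⟨!![γ 1 1, -(γ 1 0 / 2); -(2 * γ 0 1), γ 0 0], by
    obtain ⟨k, hk⟩ := (mem_Gamma0_two_iff γ).mp hγ
    have hdet := det_two_entries γ
    rw [Matrix.det_fin_two_of, hk, Int.mul_ediv_cancel_left _ two_ne_zero]
    rw [hk] at hdet
    linarith⟩

/-- `γ^W ∈ Γ₀(2)`. [folklore] -/
theorem frickeConj_mem (γ : SL(2, ℤ)) (hγ : γ ∈ Gamma0 2) : frickeConj γ hγ ∈ Gamma0 2 := by
  rw [mem_Gamma0_two_iff]
  show (2 : ℤ) ∣ (!![γ 1 1, -(γ 1 0 / 2); -(2 * γ 0 1), γ 0 0] : Matrix (Fin 2) (Fin 2) ℤ) 1 0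
  simp

/-- Coordinates of the action. [folklore] -/
theorem coe_smul_eq (γ : SL(2, ℤ)) (z : ℍ) :
    ((γ • z : ℍ) : ℂ) = (((γ 0 0 : ℤ) : ℂ) * z + ((γ 0 1 : ℤ) : ℂ)) / (((γ 1 0 : ℤ) : ℂ) * z + ((γ 1 1 : ℤ) : ℂ)) := by
  rw [UpperHalfPlane.coe_specialLinearGroup_apply]; simp

/-- The denominator does not vanish. [folklore] -/
theorem denom_int_ne_zero (γ : SL(2, ℤ)) (z : ℍ) :
    ((γ 1 0 : ℤ) : ℂ) * z + ((γ 1 1 : ℤ) : ℂ) ≠ 0 := by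
  have := UpperHalfPlane.denom_ne_zero (γ : GL (Fin 2) ℝ) z
  rw [ModularGroup.denom_apply] at this
  simpa using this

/-- `W₂ ∘ W₂ = id`. [folklore] -/
theorem frickeTwo_frickeTwo (z : ℍ) : frickeTwo (frickeTwo z) = z := by
  apply UpperHalfPlane.ext
  rw [coe_frickeTwo, coe_frickeTwo]
  have hz : (z : ℂ) ≠ 0 := z.ne_zero
  field_simp

/-- `Im W₂ z = Im z/(2|z|²)`. [folklore] -/
theorem im_frickeTwo (z : ℍ) : (frickeTwo z).im = z.im / (2 * Complex.normSq (z : ℂ)) := by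
  rw [← UpperHalfPlane.coe_im, coe_frickeTwo, Complex.div_im, Complex.neg_im, Complex.one_im,
    Complex.neg_re, Complex.one_re]
  simp [Complex.normSq_mul]
  ring

/-- Entries of `γ^W`. [folklore] -/
theorem frickeConj_entries (γ : SL(2, ℤ)) (hγ : γ ∈ Gamma0 2) :
    (frickeConj γ hγ) 0 0 = γ 1 1 ∧ (frickeConj γ hγ) 0 1 = -(γ 1 0 / 2) ∧
      (frickeConj γ hγ) 1 0 = -(2 * γ 0 1) ∧ (frickeConj γ hγ) 1 1 = γ 0 0 := by
  refine ⟨?_, ?_, ?_, ?_⟩ <;>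
    · show (!![γ 1 1, -(γ 1 0 / 2); -(2 * γ 0 1), γ 0 0] : Matrix (Fin 2) (Fin 2) ℤ) _ _ = _; simp

/-- **`W₂(γ•z) = γ^W • W₂ z`** for `γ ∈ Γ₀(2)`. [folklore] -/
theorem frickeTwo_smul (γ : SL(2, ℤ)) (hγ : γ ∈ Gamma0 2) (z : ℍ) :
    frickeTwo (γ • z) = frickeConj γ hγ • frickeTwo z := by
  obtain ⟨k, hk⟩ := (mem_Gamma0_two_iff γ).mp hγ
  obtain ⟨e00, e01, e10, e11⟩ := frickeConj_entries γ hγ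
  have hz : (z : ℂ) ≠ 0 := z.ne_zero
  have hden := denom_int_ne_zero γ z
  have hnum : ((γ 0 0 : ℤ) : ℂ) * z + ((γ 0 1 : ℤ) : ℂ) ≠ 0 := by
    intro h0
    have : ((γ • z : ℍ) : ℂ) = 0 := by rw [coe_smul_eq, h0, zero_div]
    exact (γ • z).ne_zero this
  -- both sides equal `−(cz + d)/(2(az + b))`
  have hL : ((frickeTwo (γ • z) : ℍ) : ℂ) =
      -(((γ 1 0 : ℤ) : ℂ) * z + ((γ 1 1 : ℤ) : ℂ)) / (2 * (((γ 0 0 : ℤ) : ℂ) * z + ((γ 0 1 : ℤ) : ℂ))) := by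
    rw [coe_frickeTwo, coe_smul_eq]
    field_simp
  have hR : ((frickeConj γ hγ • frickeTwo z : ℍ) : ℂ) =
      -(((γ 1 0 : ℤ) : ℂ) * z + ((γ 1 1 : ℤ) : ℂ)) / (2 * (((γ 0 0 : ℤ) : ℂ) * z + ((γ 0 1 : ℤ) : ℂ))) := by
    rw [coe_smul_eq, e00, e01, e10, e11, coe_frickeTwo, hk, Int.mul_ediv_cancel_left _ two_ne_zero]
    push_cast
    rw [div_eq_div_iff ?_ (mul_ne_zero two_ne_zero hnum)]
    · field_simp
      ring
    · -- the denominator `−2b·(−1/(2z)) + a = (az + b)/z ≠ 0`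
      rw [show -(2 * ((γ 0 1 : ℤ) : ℂ)) * (-1 / (2 * (z : ℂ))) + ((γ 0 0 : ℤ) : ℂ) =
        (((γ 0 0 : ℤ) : ℂ) * z + ((γ 0 1 : ℤ) : ℂ)) / z by field_simp; ring]
      exact div_ne_zero hnum hz
  exact UpperHalfPlane.ext (hL.trans hR.symm)

/-! ## The orbit under `Γ₀(2)⁺` -/

/-- The `Γ₀(2)⁺`-orbit of `z`: the points `γ•z` and `γ•W₂z`, `γ ∈ Γ₀(2)`. [folklore] -/
def orbTwo (z : ℍ) : Set ℍ := {u | ∃ γ : SL(2, ℤ), γ ∈ Gamma0 2 ∧ (u = γ • z ∨ u = γ • frickeTwo z)}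

/-- `z ∈ orbTwo z`. [folklore] -/
theorem mem_orbTwo_self (z : ℍ) : z ∈ orbTwo z := ⟨1, Subgroup.one_mem _, Or.inl (one_smul _ _).symm⟩

/-- `W₂ z ∈ orbTwo z`. [folklore] -/
theorem frickeTwo_mem_orbTwo (z : ℍ) : frickeTwo z ∈ orbTwo z :=
  ⟨1, Subgroup.one_mem _, Or.inr (one_smul _ _).symm⟩

/-- `γ • z ∈ orbTwo z`. [folklore] -/
theorem smul_mem_orbTwo {γ : SL(2, ℤ)} (hγ : γ ∈ Gamma0 2) (z : ℍ) : γ • z ∈ orbTwo z :=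
  ⟨γ, hγ, Or.inl rfl⟩

/-- Transitivity: the orbit of an orbit point is contained in the orbit. [folklore] -/
theorem orbTwo_subset_of_mem {z u : ℍ} (hu : u ∈ orbTwo z) : orbTwo u ⊆ orbTwo z := by
  obtain ⟨γ, hγ, hu⟩ := hu
  rintro v ⟨δ, hδ, hv⟩
  rcases hu with rfl | rfl <;> rcases hv with rfl | rfl
  · exact ⟨δ * γ, Subgroup.mul_mem _ hδ hγ, Or.inl (mul_smul _ _ _).symm⟩
  · refine ⟨δ * frickeConj γ hγ, Subgroup.mul_mem _ hδ (frickeConj_mem γ hγ), Or.inr ?_⟩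
    rw [mul_smul, frickeTwo_smul]
  · exact ⟨δ * γ, Subgroup.mul_mem _ hδ hγ, Or.inr (mul_smul _ _ _).symm⟩
  · refine ⟨δ * frickeConj γ hγ, Subgroup.mul_mem _ hδ (frickeConj_mem γ hγ), Or.inl ?_⟩
    rw [mul_smul, frickeTwo_smul, frickeTwo_frickeTwo]

/-- Symmetry of the orbit relation. [folklore] -/
theorem mem_orbTwo_symm {z u : ℍ} (hu : u ∈ orbTwo z) : z ∈ orbTwo u := by
  obtain ⟨γ, hγ, hu⟩ := hu
  rcases hu with rfl | rfl
  · exact ⟨γ⁻¹, Subgroup.inv_mem _ hγ, Or.inl (by rw [inv_smul_smul])⟩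
  · -- `z = W₂ W₂ z = W₂ (γ⁻¹ • u) = (γ⁻¹)^W • W₂ u`
    have hγ' : γ⁻¹ ∈ Gamma0 2 := Subgroup.inv_mem _ hγ
    refine ⟨frickeConj γ⁻¹ hγ', frickeConj_mem _ hγ', Or.inr ?_⟩
    rw [← frickeTwo_smul, inv_smul_smul, frickeTwo_frickeTwo]

/-- **Orbits of equivalent points coincide.** [folklore] -/
theorem orbTwo_eq_of_mem {z u : ℍ} (hu : u ∈ orbTwo z) : orbTwo u = orbTwo z :=
  Set.Subset.antisymm (orbTwo_subset_of_mem hu) (orbTwo_subset_of_mem (mem_orbTwo_symm hu))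

/-- The orbit is `Γ₀(2)`-stable. [folklore] -/
theorem orbTwo_smul {γ : SL(2, ℤ)} (hγ : γ ∈ Gamma0 2) (z : ℍ) : orbTwo (γ • z) = orbTwo z :=
  orbTwo_eq_of_mem (smul_mem_orbTwo hγ z)

/-- The orbit is `W₂`-stable. [folklore] -/
theorem orbTwo_frickeTwo (z : ℍ) : orbTwo (frickeTwo z) = orbTwo z :=
  orbTwo_eq_of_mem (frickeTwo_mem_orbTwo z)

/-! ## The fundamental domain `𝒟₂` -/

/-- `𝒟₂ := {|Re z| ≤ ½, |z|² ≥ ½}`. [folklore] -/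
def fdTwo : Set ℍ := {u | |u.re| ≤ 1 / 2 ∧ 1 / 2 ≤ Complex.normSq (u : ℂ)}

/-- Points of `𝒟₂` have `Im ≥ ½`. [folklore] -/
theorem half_le_im_of_mem_fdTwo {u : ℍ} (hu : u ∈ fdTwo) : 1 / 2 ≤ u.im := by
  obtain ⟨hre, hn⟩ := hu
  rw [Complex.normSq_apply, UpperHalfPlane.coe_re, UpperHalfPlane.coe_im] at hn
  have h1 : u.re * u.re ≤ 1 / 4 := by
    have := abs_le.mp hre; nlinarith
  have h2 : 1 / 4 ≤ u.im * u.im := by linarith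
  nlinarith [u.im_pos]

/-- In `𝒟₂`, `Im u = ½` forces `|Re u| = ½` and `|u|² = ½` (a corner). [folklore] -/
theorem corner_of_im_eq_half {u : ℍ} (hu : u ∈ fdTwo) (h : u.im = 1 / 2) :
    (u.re = 1 / 2 ∨ u.re = -(1 / 2)) ∧ Complex.normSq (u : ℂ) = 1 / 2 := by
  obtain ⟨hre, hn⟩ := hu
  rw [Complex.normSq_apply, UpperHalfPlane.coe_re, UpperHalfPlane.coe_im] at hn ⊢
  rw [h] at hn ⊢
  have h1 : u.re * u.re ≤ 1 / 4 := by
    have := abs_le.mp hre; nlinarith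
  have h2 : u.re * u.re = 1 / 4 := by linarith
  refine ⟨?_, by linarith⟩
  have : (u.re - 1 / 2) * (u.re + 1 / 2) = 0 := by nlinarith
  rcases mul_eq_zero.mp this with h0 | h0
  · left; linarith
  · right; linarith

/-! ## Heights in the orbit: `𝒟₂`-points are maximal -/

/-- Height of `γ•u`: `Im(γ u) = Im u/|cu + d|²`. [folklore] -/
theorem im_smul_eq (γ : SL(2, ℤ)) (u : ℍ) :
    (γ • u).im = u.im / Complex.normSq (((γ 1 0 : ℤ) : ℂ) * u + ((γ 1 1 : ℤ) : ℂ)) := by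
  have h := ModularGroup.im_smul_eq_div_normSq γ u
  rw [ModularGroup.denom_apply] at h
  simpa using h

/-- Height of `γ•W₂u`: `Im(γ W₂ u) = 2 Im u/|2d u − c|²`. [folklore] -/
theorem im_smul_frickeTwo_eq (γ : SL(2, ℤ)) (u : ℍ) :
    (γ • frickeTwo u).im = 2 * u.im / Complex.normSq (2 * ((γ 1 1 : ℤ) : ℂ) * u - ((γ 1 0 : ℤ) : ℂ)) := by
  rw [im_smul_eq, im_frickeTwo]
  have hu : (u : ℂ) ≠ 0 := u.ne_zero
  have hden := denom_int_ne_zero γ (frickeTwo u)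
  rw [coe_frickeTwo] at hden ⊢
  have e : ((γ 1 0 : ℤ) : ℂ) * (-1 / (2 * (u : ℂ))) + ((γ 1 1 : ℤ) : ℂ) =
      (2 * ((γ 1 1 : ℤ) : ℂ) * u - ((γ 1 0 : ℤ) : ℂ)) / (2 * u) := by
    field_simp; ring
  rw [e, Complex.normSq_div, Complex.normSq_mul]
  have hn : Complex.normSq (u : ℂ) ≠ 0 := by rwa [Ne, Complex.normSq_eq_zero]
  have hN : Complex.normSq (2 * ((γ 1 1 : ℤ) : ℂ) * u - ((γ 1 0 : ℤ) : ℂ)) ≠ 0 := by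
    intro h0
    rw [Complex.normSq_eq_zero] at h0
    apply hden; rw [e, h0, zero_div]
  simp [Complex.normSq_ofNat]
  field_simp

/-- `|cu + d|² ≥ 1` for `u ∈ 𝒟₂`, `c` even, `(c, d)` a bottom row. [folklore] -/
theorem one_le_normSq_denom {u : ℍ} (hu : u ∈ fdTwo) (γ : SL(2, ℤ)) (hγ : γ ∈ Gamma0 2) :
    1 ≤ Complex.normSq (((γ 1 0 : ℤ) : ℂ) * u + ((γ 1 1 : ℤ) : ℂ)) := by
  have him := half_le_im_of_mem_fdTwo hu
  obtain ⟨k, hk⟩ := (mem_Gamma0_two_iff γ).mp hγ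
  have hdet := det_two_entries γ
  rw [Complex.normSq_apply]
  simp only [Complex.add_re, Complex.mul_re, Complex.intCast_re, Complex.intCast_im, zero_mul,
    sub_zero, UpperHalfPlane.coe_re, UpperHalfPlane.coe_im, Complex.add_im, Complex.mul_im, add_zero]
  rcases eq_or_ne (γ 1 0) 0 with hc | hc
  · -- `c = 0`: `d = ±1`
    rw [hc] at hdet; simp at hdet
    have hd : γ 1 1 = 1 ∨ γ 1 1 = -1 := Int.eq_one_or_neg_one_of_mul_eq_one' hdet |>.elim
      (fun h => Or.inl h.2) (fun h => Or.inr h.2)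
    rw [hc]
    rcases hd with hd | hd <;> rw [hd] <;> push_cast <;> nlinarith
  · -- `|c| ≥ 2`
    have hk0 : k ≠ 0 := by rintro rfl; simp at hk; exact hc hk
    have hc2 : (4 : ℝ) ≤ ((γ 1 0 : ℤ) : ℝ) ^ 2 := by
      have : (1 : ℤ) ≤ k ^ 2 := by nlinarith [Int.one_le_abs hk0, sq_abs k]
      have h4 : (4 : ℤ) ≤ (γ 1 0) ^ 2 := by rw [hk]; nlinarith
      exact_mod_cast h4
    nlinarith [sq_nonneg (((γ 1 0 : ℤ) : ℝ) * u.re + ((γ 1 1 : ℤ) : ℝ)), u.im_pos,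
      mul_le_mul hc2 (show (1/4 : ℝ) ≤ u.im ^ 2 by nlinarith) (by norm_num) (sq_nonneg _)]

set_option maxHeartbeats 800000 in
/-- `|2du − c|² ≥ 2` for `u ∈ 𝒟₂`, `c` even, `(c, d)` a bottom row. [folklore] -/
theorem two_le_normSq_fricke_denom {u : ℍ} (hu : u ∈ fdTwo) (γ : SL(2, ℤ)) (hγ : γ ∈ Gamma0 2) :
    2 ≤ Complex.normSq (2 * ((γ 1 1 : ℤ) : ℂ) * u - ((γ 1 0 : ℤ) : ℂ)) := by
  obtain ⟨hre, hn⟩ := hu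
  obtain ⟨k, hk⟩ := (mem_Gamma0_two_iff γ).mp hγ
  have hdet := det_two_entries γ
  rw [hk] at hdet
  -- `|2du − 2k|² = 4(d²|u|² − 2dk Re u + k²)`
  have e : Complex.normSq (2 * ((γ 1 1 : ℤ) : ℂ) * u - ((γ 1 0 : ℤ) : ℂ)) =
      4 * (((γ 1 1 : ℤ) : ℝ) ^ 2 * Complex.normSq (u : ℂ) - 2 * (γ 1 1 : ℤ) * k * u.re + (k : ℝ) ^ 2) := by
    rw [hk, Complex.normSq_apply, Complex.normSq_apply]
    simp only [Complex.sub_re, Complex.mul_re, Complex.intCast_re, Complex.intCast_im, Complex.re_ofNat,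
      Complex.im_ofNat, zero_mul, sub_zero, UpperHalfPlane.coe_re, UpperHalfPlane.coe_im,
      Complex.sub_im, Complex.mul_im, add_zero]
    push_cast; ring
  rw [e]
  have hre' := abs_le.mp hre
  rcases eq_or_ne k 0 with hk0 | hk0
  · -- `c = 0`: `d = ±1`, value `4 d² |u|² ≥ 2`
    rw [hk0] at hdet ⊢; simp at hdet
    have hd2 : ((γ 1 1 : ℤ) : ℝ) ^ 2 = 1 := by
      rcases Int.eq_one_or_neg_one_of_mul_eq_one' hdet with ⟨-, h⟩ | ⟨-, h⟩ <;> rw [h] <;> norm_num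
    rw [hd2]; push_cast; nlinarith
  · -- `k ≠ 0`: `d²|u|² − 2dk Re u + k² ≥ d²/2 − |dk| + k² = (|d|−|k|)²/2 + k²/2 ≥ 1/2`
    set d : ℤ := γ 1 1 with hd
    have hk1 : (1 : ℝ) ≤ (k : ℝ) ^ 2 := by
      have : (1 : ℤ) ≤ k ^ 2 := by nlinarith [Int.one_le_abs hk0, sq_abs k]
      exact_mod_cast this
    have hA : (d : ℝ) ^ 2 / 2 ≤ (d : ℝ) ^ 2 * Complex.normSq (u : ℂ) := by
      nlinarith [sq_nonneg (d : ℝ)]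
    have hB : 2 * (d : ℝ) * k * u.re ≤ |(d : ℝ) * k| := by
      have : |2 * (d : ℝ) * k * u.re| ≤ |(d : ℝ) * k| := by
        rw [show 2 * (d : ℝ) * k * u.re = ((d : ℝ) * k) * (2 * u.re) by ring, abs_mul]
        have : |2 * u.re| ≤ 1 := by rw [abs_le]; constructor <;> linarith
        nlinarith [abs_nonneg ((d : ℝ) * k)]
      linarith [le_abs_self (2 * (d : ℝ) * k * u.re)]
    have habs : |(d : ℝ) * k| = |(d : ℝ)| * |(k : ℝ)| := abs_mul _ _
    have hsq : (|(d : ℝ)| - |(k : ℝ)|) ^ 2 = (d : ℝ) ^ 2 - 2 * (|(d : ℝ)| * |(k : ℝ)|) + (k : ℝ) ^ 2 := by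
      rw [sub_sq, sq_abs, sq_abs]; ring
    nlinarith [sq_nonneg (|(d : ℝ)| - |(k : ℝ)|)]

/-- **Heights in the orbit are bounded by the height of a `𝒟₂`-representative.** [folklore] -/
theorem im_le_of_mem_fdTwo {u : ℍ} (hu : u ∈ fdTwo) (γ : SL(2, ℤ)) (hγ : γ ∈ Gamma0 2) :
    (γ • u).im ≤ u.im ∧ (γ • frickeTwo u).im ≤ u.im := by
  constructor
  · rw [im_smul_eq]
    exact div_le_self u.im_pos.le (one_le_normSq_denom hu γ hγ)
  · rw [im_smul_frickeTwo_eq, div_le_iff₀ (lt_of_lt_of_le two_pos (two_le_normSq_fricke_denom hu γ hγ))]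
    nlinarith [two_le_normSq_fricke_denom hu γ hγ, u.im_pos]

/-- Every point of the orbit of a `𝒟₂`-point has smaller height. [folklore] -/
theorem im_le_of_mem_orbTwo {u v : ℍ} (hu : u ∈ fdTwo) (hv : v ∈ orbTwo u) : v.im ≤ u.im := by
  obtain ⟨γ, hγ, hv⟩ := hv
  rcases hv with rfl | rfl
  · exact (im_le_of_mem_fdTwo hu γ hγ).1
  · exact (im_le_of_mem_fdTwo hu γ hγ).2

/-! ## Equality cases off the corners -/

/-- An element of `Γ₀(2)` with `c = 0` acts as an integer translation. [folklore] -/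
theorem smul_eq_vadd_of_bottom_left_eq_zero (γ : SL(2, ℤ)) (hc : γ 1 0 = 0) (z : ℍ) :
    ∃ n : ℤ, γ • z = ((n : ℝ)) +ᵥ z := by
  have hdet := det_two_entries γ
  rw [hc] at hdet; simp at hdet
  refine ⟨γ 0 1 * γ 1 1, UpperHalfPlane.ext ?_⟩
  rw [coe_smul_eq, UpperHalfPlane.coe_vadd, hc]
  push_cast
  rcases Int.eq_one_or_neg_one_of_mul_eq_one' hdet with ⟨ha, hd⟩ | ⟨ha, hd⟩
  · rw [ha, hd]; push_cast; ring
  · rw [ha, hd]; push_cast; ring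

/-- **Equality case I**: `u ∈ 𝒟₂` with `Im u > ½` and `Im(γ•u) = Im u` force `γ•u = u + n`.
[folklore] -/
theorem eq_vadd_of_im_eq {u : ℍ} (hu : u ∈ fdTwo) (hcorner : 1 / 2 < u.im) (γ : SL(2, ℤ))
    (hγ : γ ∈ Gamma0 2) (h : (γ • u).im = u.im) : ∃ n : ℤ, γ • u = ((n : ℝ)) +ᵥ u := by
  apply smul_eq_vadd_of_bottom_left_eq_zero
  by_contra hc
  obtain ⟨k, hk⟩ := (mem_Gamma0_two_iff γ).mp hγ
  have hk0 : k ≠ 0 := by rintro rfl; simp at hk; exact hc hk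
  rw [im_smul_eq, div_eq_iff (by
    have := one_le_normSq_denom hu γ hγ; linarith), eq_comm, mul_eq_left₀ u.im_pos.ne'] at h
  -- `|cu+d|² = 1` but `≥ c² Im² ≥ 4 Im² > 1`
  rw [Complex.normSq_apply] at h
  simp only [Complex.add_re, Complex.mul_re, Complex.intCast_re, Complex.intCast_im, zero_mul,
    sub_zero, UpperHalfPlane.coe_re, UpperHalfPlane.coe_im, Complex.add_im, Complex.mul_im, add_zero] at h
  have hc2 : (4 : ℝ) ≤ ((γ 1 0 : ℤ) : ℝ) ^ 2 := by
    have : (1 : ℤ) ≤ k ^ 2 := by nlinarith [Int.one_le_abs hk0, sq_abs k]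
    have h4 : (4 : ℤ) ≤ (γ 1 0) ^ 2 := by rw [hk]; nlinarith
    exact_mod_cast h4
  nlinarith [sq_nonneg (((γ 1 0 : ℤ) : ℝ) * u.re + ((γ 1 1 : ℤ) : ℝ)),
    mul_le_mul hc2 (show (1/4 : ℝ) < u.im ^ 2 by nlinarith).le (by norm_num) (sq_nonneg _)]

set_option maxHeartbeats 800000 in
/-- **Equality case II**: `u ∈ 𝒟₂` with `Im u > ½` and `Im(γ•W₂u) = Im u` force `|u|² = ½` and
`γ•W₂u = W₂u + n`. [folklore] -/
theorem eq_vadd_fricke_of_im_eq {u : ℍ} (hu : u ∈ fdTwo) (hcorner : 1 / 2 < u.im) (γ : SL(2, ℤ))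
    (hγ : γ ∈ Gamma0 2) (h : (γ • frickeTwo u).im = u.im) :
    Complex.normSq (u : ℂ) = 1 / 2 ∧ ∃ n : ℤ, γ • frickeTwo u = ((n : ℝ)) +ᵥ frickeTwo u := by
  obtain ⟨hre, hn⟩ := hu
  obtain ⟨k, hk⟩ := (mem_Gamma0_two_iff γ).mp hγ
  have hdet := det_two_entries γ
  rw [hk] at hdet
  have h2 := two_le_normSq_fricke_denom ⟨hre, hn⟩ γ hγ
  rw [im_smul_frickeTwo_eq, div_eq_iff (by linarith), eq_comm] at h
  have hN : Complex.normSq (2 * ((γ 1 1 : ℤ) : ℂ) * u - ((γ 1 0 : ℤ) : ℂ)) = 2 := by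
    nlinarith [u.im_pos]
  -- expand
  have e : Complex.normSq (2 * ((γ 1 1 : ℤ) : ℂ) * u - ((γ 1 0 : ℤ) : ℂ)) =
      4 * (((γ 1 1 : ℤ) : ℝ) ^ 2 * Complex.normSq (u : ℂ) - 2 * (γ 1 1 : ℤ) * k * u.re + (k : ℝ) ^ 2) := by
    rw [hk, Complex.normSq_apply, Complex.normSq_apply]
    simp only [Complex.sub_re, Complex.mul_re, Complex.intCast_re, Complex.intCast_im, Complex.re_ofNat,
      Complex.im_ofNat, zero_mul, sub_zero, UpperHalfPlane.coe_re, UpperHalfPlane.coe_im,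
      Complex.sub_im, Complex.mul_im, add_zero]
    push_cast; ring
  rw [e] at hN
  have hre' := abs_le.mp hre
  -- `Im u > 1/2` with `|Re u| ≤ 1/2`: `|u|² > 1/2` unless... we show `k = 0`
  have hk0 : k = 0 := by
    by_contra hk0
    have hk1 : (1 : ℝ) ≤ (k : ℝ) ^ 2 := by
      have : (1 : ℤ) ≤ k ^ 2 := by nlinarith [Int.one_le_abs hk0, sq_abs k]
      exact_mod_cast this
    set d : ℤ := γ 1 1 with hd
    have hN' : (d : ℝ) ^ 2 * Complex.normSq (u : ℂ) - 2 * d * k * u.re + (k : ℝ) ^ 2 = 1 / 2 := by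
      linarith
    -- lower bounds
    have hA : 0 ≤ (d : ℝ) ^ 2 * Complex.normSq (u : ℂ) - (d : ℝ) ^ 2 / 2 := by
      nlinarith [sq_nonneg (d : ℝ)]
    have hB : 0 ≤ |(d : ℝ) * k| - 2 * d * k * u.re := by
      have : |2 * (d : ℝ) * k * u.re| ≤ |(d : ℝ) * k| := by
        rw [show 2 * (d : ℝ) * k * u.re = ((d : ℝ) * k) * (2 * u.re) by ring, abs_mul]
        have : |2 * u.re| ≤ 1 := by rw [abs_le]; constructor <;> linarith
        nlinarith [abs_nonneg ((d : ℝ) * k)]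
      linarith [le_abs_self (2 * (d : ℝ) * k * u.re)]
    have habs : |(d : ℝ) * k| = |(d : ℝ)| * |(k : ℝ)| := abs_mul _ _
    have hsq : (|(d : ℝ)| - |(k : ℝ)|) ^ 2 = (d : ℝ) ^ 2 - 2 * (|(d : ℝ)| * |(k : ℝ)|) + (k : ℝ) ^ 2 := by
      rw [sub_sq, sq_abs, sq_abs]; ring
    -- `(d²/2 − |dk| + k²) ≤ 1/2`, and it equals `(|d|−|k|)²/2 + k²/2 ≥ k²/2 ≥ 1/2`
    have hle : (d : ℝ) ^ 2 / 2 - |(d : ℝ) * k| + (k : ℝ) ^ 2 ≤ 1 / 2 := by linarith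
    have hk2 : (k : ℝ) ^ 2 ≤ 1 := by nlinarith [sq_nonneg (|(d : ℝ)| - |(k : ℝ)|)]
    have hk3 : (k : ℝ) ^ 2 = 1 := le_antisymm hk2 hk1
    have hdk : (|(d : ℝ)| - |(k : ℝ)|) ^ 2 = 0 := by nlinarith [sq_nonneg (|(d : ℝ)| - |(k : ℝ)|)]
    have hdk' : |(d : ℝ)| = |(k : ℝ)| := by nlinarith [sq_nonneg (|(d : ℝ)| - |(k : ℝ)|)]
    have hk4 : |(k : ℝ)| = 1 := by
      have : |(k : ℝ)| ^ 2 = 1 := by rw [sq_abs]; exact hk3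
      nlinarith [abs_nonneg (k : ℝ)]
    have hd1 : |(d : ℝ)| = 1 := by rw [hdk', hk4]
    have hd2 : (d : ℝ) ^ 2 = 1 := by rw [← sq_abs, hd1]; norm_num
    have hdkabs : |(d : ℝ) * k| = 1 := by rw [habs, hd1, hk4]; norm_num
    -- tightness: `A = B = 0`
    have hA0 : (d : ℝ) ^ 2 * Complex.normSq (u : ℂ) - (d : ℝ) ^ 2 / 2 = 0 := by nlinarith
    have hB0 : |(d : ℝ) * k| - 2 * d * k * u.re = 0 := by nlinarith
    have hns : Complex.normSq (u : ℂ) = 1 / 2 := by rw [hd2] at hA0; linarith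
    have hre2 : u.re ^ 2 = 1 / 4 := by
      have h1 : 2 * (d : ℝ) * k * u.re = 1 := by rw [hdkabs] at hB0; linarith
      have h2 : ((d : ℝ) * k) ^ 2 = 1 := by rw [← sq_abs, hdkabs]; norm_num
      nlinarith
    have hnorm : Complex.normSq (u : ℂ) = u.re ^ 2 + u.im ^ 2 := by
      rw [Complex.normSq_apply, UpperHalfPlane.coe_re, UpperHalfPlane.coe_im]; ring
    have him2 : u.im ^ 2 = 1 / 4 := by rw [hnorm, hre2] at hns; linarith
    have : u.im = 1 / 2 := by nlinarith [u.im_pos]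
    linarith
  -- `k = 0`: `c = 0`, translation, and `|u|² = 1/2`
  have hc : γ 1 0 = 0 := by rw [hk, hk0]; ring
  rw [hk0] at hdet hN; simp at hdet
  have hd2 : ((γ 1 1 : ℤ) : ℝ) ^ 2 = 1 := by
    rcases Int.eq_one_or_neg_one_of_mul_eq_one' hdet with ⟨-, h⟩ | ⟨-, h⟩ <;> rw [h] <;> norm_num
  rw [hd2] at hN; push_cast at hN
  refine ⟨by nlinarith, ?_⟩
  exact smul_eq_vadd_of_bottom_left_eq_zero γ hc _

/-! ## Existence of representatives -/

/-- Heights are maximised over `Γ₀(2)`. [folklore] -/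
theorem exists_max_im_Gamma0_two (z : ℍ) :
    ∃ g : SL(2, ℤ), g ∈ Gamma0 2 ∧ ∀ g' : SL(2, ℤ), g' ∈ Gamma0 2 → (g' • z).im ≤ (g • z).im := by
  classical
  let s : Set (Fin 2 → ℤ) := {cd | IsCoprime (cd 0) (cd 1) ∧ (2 : ℤ) ∣ cd 0}
  have hs : s.Nonempty := ⟨![0, 1], by simp [s, isCoprime_one_right]⟩
  obtain ⟨p, ⟨hp_coprime, hp2⟩, hp⟩ :=
    Filter.Tendsto.exists_within_forall_le hs (ModularGroup.tendsto_normSq_coprime_pair z)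
  obtain ⟨g, -, hg⟩ := ModularGroup.bottom_row_surj hp_coprime
  have hg2 : g ∈ Gamma0 2 := by
    rw [mem_Gamma0_two_iff]
    have : (g : Matrix (Fin 2) (Fin 2) ℤ) 1 0 = p 0 := by rw [← hg]
    rw [this]; exact hp2
  refine ⟨g, hg2, fun g' hg' => ?_⟩
  rw [ModularGroup.im_smul_eq_div_normSq, ModularGroup.im_smul_eq_div_normSq,
    div_le_div_iff_of_pos_left]
  · have h' := hp (g' 1) ⟨ModularGroup.bottom_row_coprime g', (mem_Gamma0_two_iff g').mp hg'⟩
    simpa [← hg, ModularGroup.denom_apply] using h'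
  · exact z.im_pos
  · exact UpperHalfPlane.normSq_denom_pos g' z.im_ne_zero
  · exact UpperHalfPlane.normSq_denom_pos g z.im_ne_zero

/-- A point of maximal height in the `Γ₀(2)⁺`-orbit. [folklore] -/
theorem exists_max_im_orbTwo (z : ℍ) : ∃ u ∈ orbTwo z, ∀ v ∈ orbTwo z, v.im ≤ u.im := by
  obtain ⟨g₁, hg₁, h₁⟩ := exists_max_im_Gamma0_two z
  obtain ⟨g₂, hg₂, h₂⟩ := exists_max_im_Gamma0_two (frickeTwo z)
  rcases le_total (g₂ • frickeTwo z).im (g₁ • z).im with h | h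
  · refine ⟨g₁ • z, ⟨g₁, hg₁, Or.inl rfl⟩, ?_⟩
    rintro v ⟨γ, hγ, rfl | rfl⟩
    · exact h₁ γ hγ
    · exact (h₂ γ hγ).trans h
  · refine ⟨g₂ • frickeTwo z, ⟨g₂, hg₂, Or.inr rfl⟩, ?_⟩
    rintro v ⟨γ, hγ, rfl | rfl⟩
    · exact (h₁ γ hγ).trans h
    · exact h₂ γ hγ

/-- Integer translates lie in `Γ₀(2)`-orbits. [folklore] -/
theorem vadd_int_mem_orbTwo (z : ℍ) (n : ℤ) : ((n : ℝ)) +ᵥ z ∈ orbTwo z := by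
  refine ⟨ModularGroup.T ^ n, ?_, Or.inl ?_⟩
  · rw [mem_Gamma0_two_iff, ModularGroup.coe_T_zpow]; simp
  · rw [UpperHalfPlane.modular_T_zpow_smul]

/-- **Every `Γ₀(2)⁺`-orbit meets `𝒟₂`.** [folklore] -/
theorem exists_mem_orbTwo_mem_fdTwo (z : ℍ) : ∃ u ∈ orbTwo z, u ∈ fdTwo := by
  obtain ⟨u₀, hu₀, hmax⟩ := exists_max_im_orbTwo z
  -- translate into the strip
  set n : ℤ := -⌊u₀.re + 1 / 2⌋ with hn
  set u : ℍ := ((n : ℝ)) +ᵥ u₀ with hu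
  have hu_orb : u ∈ orbTwo z := orbTwo_subset_of_mem hu₀ (vadd_int_mem_orbTwo u₀ n)
  have hu_im : u.im = u₀.im := by rw [hu, UpperHalfPlane.vadd_im]
  have hu_re : |u.re| ≤ 1 / 2 := by
    rw [hu, UpperHalfPlane.vadd_re, hn]
    have h1 := Int.floor_le (u₀.re + 1 / 2)
    have h2 := Int.lt_floor_add_one (u₀.re + 1 / 2)
    rw [abs_le]; push_cast; constructor <;> linarith
  refine ⟨u, hu_orb, hu_re, ?_⟩
  -- `|u|² ≥ 1/2` from maximality against `W₂ u`
  have hW : (frickeTwo u).im ≤ u.im := by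
    rw [hu_im]
    exact hmax _ (orbTwo_subset_of_mem hu_orb (frickeTwo_mem_orbTwo u))
  rw [im_frickeTwo] at hW
  have hn0 : 0 < Complex.normSq (u : ℂ) := Complex.normSq_pos.mpr u.ne_zero
  rw [div_le_iff₀ (by positivity)] at hW
  nlinarith [u.im_pos]

/-- `W₂` maps `𝒟₂`-points of the arc `|u|² = ½` to the arc. [folklore] -/
theorem normSq_frickeTwo (u : ℍ) : Complex.normSq ((frickeTwo u : ℍ) : ℂ) = 1 / (4 * Complex.normSq (u : ℂ)) := by
  have h2 : Complex.normSq (2 * (u : ℂ)) = 4 * Complex.normSq (u : ℂ) := by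
    rw [Complex.normSq_mul]; simp [Complex.normSq_apply]; norm_num
  rw [coe_frickeTwo, Complex.normSq_div, h2, Complex.normSq_neg, Complex.normSq_one]

end Literature.NumberTheory.ModularForms
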